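import Summits.NavierStokesRegularity.NavierStokesRegularity.Theorems.WakeRatchetEternalInviscidRateDSSRate
import Summits.NavierStokesRegularity.NavierStokesRegularity.Theorems.WakeRatchetBlockRateGlue

/-!
# Route `WakeRatchet` — the BLOCK rate ratchet pins self-similar fronts EXACTLY as the per-shell one does
# (helper for ⟨stmt-NavierStokesRegularity-25646⟩ `EternalInviscidRate`; repair census in kernel form)

The O-2 block repair of the per-shell rate cruxes (planner LINE g11-2; block bookkeeping landed def-free in `WakeRatchetBlockRateGlue`,
`WakeRatchetRatchetStarvationBlock`, `WakeRatchetClosesBlock`) weakens ⟨25646⟩ on PULSATING / uneven fronts.  This file shows it does NOT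
weaken it on the self-similar stratum: a contraction by `(1+ε₀)^{−ab}` over blocks of ANY length `b ≥ 1` along a block-self-similar bounded
admissible eternal solution (`W_{n+p}(σ) = W_n(σ − T)`, block ratio `ϱ = e^{2T}Λ^{−2p}`) forces `ϱ ≤ ((1+ε₀)^{−a})^p` — the same pin as the
per-shell contraction (landed `WakeRatchetDSS.blockRatio_le_of_rateContraction`, `b = 1`).  Hence:

* `period_iterate` — `W_{n+pj}(σ) = W_n(σ − jT)` for a period-`p` field.
* `blockRatio_le_of_blockRateContraction` — the pin `ϱ ≤ ((1+ε₀)^{−a})^p` from a `b`-block contraction (iterate the block `p` times with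
  `WakeRatchetBlockRate.block_iterate`, shift the period `b` times with `tail_shift`, compare suprema, take the `b`-th root).
* `dssMu_le_of_blockInviscidRate` — the BLOCK form of ⟨25646⟩ at spread `R` (written out) ⇒ every non-trivial admissible DSS wave of every
  `E₂(R)` table below `εs` has `dssMu ≤ (1+ε₀)^{−a}` (front exponent `y ≥ a/5 > 1/5`) — verbatim the conclusion the per-shell crux gives
  (`dssMu_le_of_eternalInviscidRate`, p819021).
* `blockInviscidRate_false_of_survivingDSSWaves` — so the SURVIVING-DSS kill criterion of ⟨25646⟩ (`EternalInviscidRate_false_of_survivingDSSWaves`)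
  carries over VERBATIM to the block form: non-trivial admissible DSS waves with `(1+ε₀)^{−1} ≤ dssMu` on one fixed class at arbitrarily small
  `ε₀` refute the block repair too.  The block re-typing answers O-2 (per-shell fluctuations), not the DSS-survival obstruction.
HONEST LABEL: bookkeeping; hypotheses NOT supplied by the tree; no registered stub is closed; block statements are NOT route items; MODEL lattice
only (Tao 2016 §4); nothing here bears on the Navier–Stokes equations or the summit.
[cite: Tao2016AveragedNS, §4 Lemma 4.1 (4.8)–(4.10), (4.3), Thm. 4.2 (statement shape), §6.4; cell vocabulary (`dssMu`, `IsDSSWave`)]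
-/

noncomputable section

set_option linter.dupNamespace false

namespace Summit.NavierStokesRegularity.NavierStokesRegularity.Theorems

namespace WakeRatchetDSS

open Filter Topology
open Literature.Analysis.FluidPDE Literature.Analysis.FluidPDE.TaoCascade
open WakeRatchetTail

variable {m : ℕ} {ε₀ : ℝ} {W : ℤ → ℝ → Em m}

/-- A period-`p` block-self-similar field iterates: `W_{n + p·j}(σ) = W_n(σ − j·T)`.
[cite: Tao2016AveragedNS, §4 Lemma 4.1 (4.8) in self-similar variables; elementary induction] -/
theorem period_iterate {p : ℕ} {T : ℝ} (hD : ∀ (n : ℤ) (σ : ℝ), W (n + p) σ = W n (σ - T)) :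
    ∀ (j : ℕ) (n : ℤ) (σ : ℝ), W (n + ((p * j : ℕ) : ℤ)) σ = W n (σ - j * T) := by
  intro j
  induction j with
  | zero => intro n σ; simp
  | succ j ih =>
    intro n σ
    have e : n + ((p * (j + 1) : ℕ) : ℤ) = n + ((p * j : ℕ) : ℤ) + p := by push_cast; ring
    rw [e, hD, ih]
    congr 1; push_cast; ring

/-- **Block contraction pins the block ratio — with the per-shell exponent.**  On a cancelling table, a NON-TRIVIAL uniformly bounded
admissible eternal solution (any covariant viscosity `ν̂ ≥ 0`) that is block-self-similar (`W_{n+p}(σ) = W_n(σ − T)`) and whose tails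
contract by `(1+ε₀)^{−ab}` over blocks of `b ≥ 1` shells has `e^{2T}Λ^{−2p} ≤ ((1+ε₀)^{−a})^p` — independently of `b`.
[cite: Tao2016AveragedNS, §4 Lemma 4.1 (4.8)–(4.10) with (4.3), §6.4; cell vocabulary] -/
theorem blockRatio_le_of_blockRateContraction (hε : 0 < ε₀) {νh : ℝ}
    {α : Fin m → Fin m → Fin m → ℤ × ℤ × ℤ → ℝ}
    (hc : IsCancellingCoeff α) (hW : IsEternalVisc ε₀ νh α W) (hU : UniformBound W) {p : ℕ} {T a : ℝ}
    (hD : ∀ (n : ℤ) (σ : ℝ), W (n + p) σ = W n (σ - T)) {b : ℕ} (hb : 1 ≤ b)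
    (hRate : ∀ (n : ℤ) (M : ℝ), (∀ σ : ℝ, ∑' k : ℕ, physEnergy ε₀ W (n + k) σ ≤ M) →
      ∀ σ : ℝ, ∑' k : ℕ, physEnergy ε₀ W (n + b + k) σ ≤ (1 + ε₀) ^ (-(a * b)) * M)
    {n₀ : ℤ} {σ₀ : ℝ} (hne : W n₀ σ₀ ≠ 0) :
    Real.exp (2 * T) * (bigLam ε₀ ^ p)⁻¹ ^ 2 ≤ ((1 + ε₀) ^ (-a)) ^ p := by
  have h1ε : 0 < 1 + ε₀ := by linarith
  set ϱ : ℝ := Real.exp (2 * T) * (bigLam ε₀ ^ p)⁻¹ ^ 2 with hϱ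
  set q : ℝ := (1 + ε₀) ^ (-a) with hq
  have hρ0 : 0 ≤ ϱ := (blockRatio_pos hε p T).le
  have hq0 : 0 ≤ q := Real.rpow_nonneg h1ε.le _
  -- the tail at shell `n₀` and its supremum
  set Θ : ℝ → ℝ := fun σ => ∑' k : ℕ, physEnergy ε₀ W (n₀ + k) σ with hΘ
  obtain ⟨M, hM⟩ := TailEnvelopeFinite.main hε hc hW hU n₀
  have hbdd : BddAbove (Set.range Θ) := ⟨M, by rintro _ ⟨σ, rfl⟩; exact hM σ⟩
  set S : ℝ := ⨆ σ, Θ σ with hS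
  have hle : ∀ σ, Θ σ ≤ S := fun σ => le_ciSup hbdd σ
  have hSpos : 0 < S :=
    lt_of_lt_of_le (lt_of_lt_of_le (physEnergy_pos_of_ne hε hne) (physEnergy_le_tail hε hU n₀ σ₀))
      (hle σ₀)
  -- iterate the block contraction `p` times: the tail above `n₀ + p·b` is `≤ q^{bp}·S`... written as a real power
  have hit := WakeRatchetBlockRate.block_iterate (W := W) hε hRate n₀ S hle p
  -- the `b`-fold period shift: `W_{n + (p·b)}(σ) = W_n(σ − bT)`
  have hDb : ∀ (n : ℤ) (σ : ℝ), W (n + ((p * b : ℕ) : ℤ)) σ = W n (σ - b * T) := period_iterate hD b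
  -- block ratio of the `b`-fold period is `ϱ^b`
  have hρb : Real.exp (2 * (b * T)) * (bigLam ε₀ ^ (p * b))⁻¹ ^ 2 = ϱ ^ b := by
    rw [hϱ, mul_pow, ← Real.exp_nat_mul, pow_mul, ← inv_pow, ← inv_pow, ← pow_mul, ← pow_mul]
    congr 1
    · congr 1; ring
    · ring
  have hall : ∀ σ, ϱ ^ b * Θ σ ≤ (1 + ε₀) ^ (-(a * b * p)) * S := by
    intro σ
    have h1 := hit (σ + b * T)
    have h2 := tail_shift hε hDb n₀ (σ + b * T)
    rw [add_sub_cancel_right, hρb] at h2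
    rw [h2] at h1
    exact h1
  have hmul : ϱ ^ b * S ≤ (1 + ε₀) ^ (-(a * b * p)) * S := by
    rw [hS, Real.mul_iSup_of_nonneg (pow_nonneg hρ0 b)]
    exact ciSup_le hall
  have hpow : ϱ ^ b ≤ (1 + ε₀) ^ (-(a * b * p)) := le_of_mul_le_mul_right hmul hSpos
  -- `(1+ε₀)^{−abp} = (q^p)^b`; take the `b`-th root
  have hexp : (1 + ε₀) ^ (-(a * b * p)) = (q ^ p) ^ b := by
    rw [hq, ← Real.rpow_natCast, ← Real.rpow_natCast, ← Real.rpow_mul h1ε.le, ← Real.rpow_mul h1ε.le]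
    congr 1; ring
  rw [hexp] at hpow
  have hb0 : b ≠ 0 := by omega
  exact (pow_le_pow_iff_left₀ hρ0 (pow_nonneg hq0 p) hb0).1 hpow

/-- **The BLOCK form of ⟨25646⟩ pins every fixed-spread self-similar front below the rate line — same as the per-shell crux.**  If at
spread `R` the block inviscid rate ratchet holds (exponent `a`, threshold `εs`, block length `b(ε₀) ≥ 1`; written out), then every
non-trivial admissible DSS wave of every `E₂(R)` table at `0 < ε₀ ≤ εs` has `dssMu ε₀ T ≤ (1+ε₀)^{−a}`.  MODEL lattice only.
[cite: Tao2016AveragedNS, §4 Lemma 4.1 (4.8)–(4.10), (4.3), Thm. 4.2 (statement shape), §6.4] -/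
theorem dssMu_le_of_blockInviscidRate {R a εs : ℝ}
    (H : ∀ ε₀ : ℝ, 0 < ε₀ → ε₀ ≤ εs →
      ∃ b : ℕ, 1 ≤ b ∧
      ∀ α : Fin 4 → Fin 4 → Fin 4 → ℤ × ℤ × ℤ → ℝ, InTableClass R α →
      ∀ W : ℤ → ℝ → Em 4, IsEternal ε₀ α W → UniformBound W →
      ∀ (n : ℤ) (M : ℝ), (∀ σ : ℝ, ∑' k : ℕ, physEnergy ε₀ W (n + k) σ ≤ M) →
        ∀ σ : ℝ, ∑' k : ℕ, physEnergy ε₀ W (n + b + k) σ ≤ (1 + ε₀) ^ (-(a * b)) * M)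
    {ε₀ : ℝ} (hε₀ : 0 < ε₀) (hle : ε₀ ≤ εs)
    {α : Fin 4 → Fin 4 → Fin 4 → ℤ × ℤ × ℤ → ℝ} (hα : InTableClass R α)
    {q : ℕ} {π : Equiv.Perm (Fin q)} {T : ℝ} {Φ : Fin q → ℝ → Em 4}
    (hW : IsDSSWave ε₀ α π T Φ) (hne : ∃ r x, Φ r x ≠ 0) :
    dssMu ε₀ T ≤ (1 + ε₀) ^ (-a) := by
  obtain ⟨b, hb, Hb⟩ := H ε₀ hε₀ hle
  obtain ⟨r, x, hne⟩ := hne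
  have hp : 0 < orderOf π := orderOf_pos π
  have hE : IsEternal ε₀ α (dssEmbed π T Φ r) := hW.isEternal_dssEmbed r
  have hU : UniformBound (dssEmbed π T Φ r) := uniformBound_dssEmbed hW r
  have hne' : dssEmbed π T Φ r 0 x ≠ 0 := by simpa [dssEmbed] using hne
  have hpin := blockRatio_le_of_blockRateContraction hε₀ hα.2.1 hE.isEternalVisc hU (T := orderOf π * T)
    (dssEmbed_shift π T Φ r) hb (fun n M hM σ => Hb α hα _ hE hU n M hM σ) hne'
  rw [blockRatio_orderOf_eq_pow hε₀.le] at hpin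
  have hμ0 : 0 ≤ dssMu ε₀ T := (dssMu_pos T (by linarith)).le
  have hq0 : 0 ≤ (1 + ε₀) ^ (-a) := Real.rpow_nonneg (by linarith) _
  exact (pow_le_pow_iff_left₀ hμ0 hq0 hp.ne').1 hpin

/-- **Kill criterion carried over to the block repair.**  Non-trivial admissible DSS waves with `(1+ε₀)^{−1} ≤ dssMu ε₀ T` on the tables of
ONE fixed class `E₂(R)` at arbitrarily small scale ratios refute the BLOCK form of ⟨25646⟩ at that `R` for EVERY exponent `a > 1`, every
threshold and every block-length schedule — exactly as they refute the per-shell crux (`EternalInviscidRate_false_of_survivingDSSWaves`).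
The existence hypothesis is NOT supplied by the tree.  MODEL lattice only.
[cite: Tao2016AveragedNS, §4 Thm. 4.2 (statement shape), §6.4] -/
theorem blockInviscidRate_false_of_survivingDSSWaves {R : ℝ}
    (hF : ∀ ε : ℝ, 0 < ε → ∃ ε₀ : ℝ, 0 < ε₀ ∧ ε₀ ≤ ε ∧
      ∃ α : Fin 4 → Fin 4 → Fin 4 → ℤ × ℤ × ℤ → ℝ, InTableClass R α ∧
        ∃ (q : ℕ) (π : Equiv.Perm (Fin q)) (T : ℝ) (Φ : Fin q → ℝ → Em 4),
          IsDSSWave ε₀ α π T Φ ∧ (1 + ε₀) ^ (-(1 : ℝ)) ≤ dssMu ε₀ T ∧ ∃ r x, Φ r x ≠ 0) :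
    ¬ (∃ a : ℝ, 1 < a ∧ ∃ εs : ℝ, 0 < εs ∧ ∀ ε₀ : ℝ, 0 < ε₀ → ε₀ ≤ εs →
      ∃ b : ℕ, 1 ≤ b ∧
      ∀ α : Fin 4 → Fin 4 → Fin 4 → ℤ × ℤ × ℤ → ℝ, InTableClass R α →
      ∀ W : ℤ → ℝ → Em 4, IsEternal ε₀ α W → UniformBound W →
      ∀ (n : ℤ) (M : ℝ), (∀ σ : ℝ, ∑' k : ℕ, physEnergy ε₀ W (n + k) σ ≤ M) →
        ∀ σ : ℝ, ∑' k : ℕ, physEnergy ε₀ W (n + b + k) σ ≤ (1 + ε₀) ^ (-(a * b)) * M) := by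
  rintro ⟨a, ha, εs, hεs, H⟩
  obtain ⟨ε₀, hε₀, hle, α, hα, q, π, T, Φ, hW, hS, hne⟩ := hF εs hεs
  have hμ := dssMu_le_of_blockInviscidRate H hε₀ hle hα hW hne
  have h1 : 1 < 1 + ε₀ := by linarith
  have hlt : (1 + ε₀) ^ (-a) < (1 + ε₀) ^ (-(1 : ℝ)) := Real.rpow_lt_rpow_of_exponent_lt h1 (by linarith)
  exact absurd (hS.trans hμ) (not_le.mpr hlt)

end WakeRatchetDSS

end Summit.NavierStokesRegularity.NavierStokesRegularity.Theorems

end
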